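import Summits.QuantumFields.YangMills.Theorems.UnitScaleTiltProp7DfixInvariant
import HarnessLib

/-!
# Route `UnitScaleTilt`, crux K1 child «MinimiserStabilityRegPr» (stmt-QuantumFields-19200), skeleton v10, stub `stub_existenceMinimalOrbit` (EX), route (α) — **(CH-KNIT v2-tw), THE REALITY
# SPLIT OF THE (CH5EL-tw)″ DISPLAY, FRAME-FREE PART**: the chart exponent `X = A′ − HD(A′)` of [Balaban1985Variational] (47)∕(112) lies in a closed real subspace `S` («`𝔤`-valued», i.e.
# `i·𝔰𝔲(2)`-valued fields) as soon as (i) the chart parameter `A′ ∈ S`, (ii) the letter `H` maps real data to real fields (`H(S′) ⊆ S`), and (iii) the NONLINEAR chart `f` (the twisted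
# log-average `A ↦ log U̿(A)`, ANY frame convention) maps `S` into the real data `S′` — because then its linear part `Q = f′(0)` and its remainder `C = f − Q` do too (a real-direction
# difference quotient of an `S → S′` map stays in the closed `S′`), and print's fixed point `D(A′) = C(A′ − HD(A′))` does by `Prop7DfixInvariant.Dfix_mem_of_invariant`.  Frame-free:
# survives the re-basing of the EX frames (★★OWNER RULING g26-№12) and serves the `ˢ` objects verbatim

Cell `ym3-torus`, width seat `ym-ust-19200-w2` (gen 3; KNIT RULER).  THEOREMS ONLY (0 `def`, 0 `sorry`).  Bookkeeping ∕ calculus plumbing: nothing here closes the stub; `--supports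
stmt-QuantumFields-19200 --as helper`, count-neutral.  YM₃ on T³ is a ladder rung (R3), not the Clay problem; nothing here claims the stub, the crux, d = 4 or the mass gap.

THE PRINT.  [Balaban1985Variational] p. 286 (51): «We consider configurations A′, X with values in the complexified Lie algebra 𝔤ᶜ … for A′ with values in 𝔤 the configuration D(A′) has
values in 𝔤 also»; (44)∕(3.14) of [Balaban1985BackgroundPropagators] p. 393: «Q_j(U)A is a linear part of the function (3.13) and C_j(U, A) is an analytic function of A whose expansion
begins with second order terms» — for unitary data the function (3.13) is `𝔤`-valued, hence so are its linear part and its remainder.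

WHAT IS PROVED (sorry-free, no definition; abstract complex Banach spaces `E ∋ A` (fine fields), `F ∋ X` (coarse data); `S ⊆ E`, `S′ ⊆ F` closed REAL submodules).  §1 ★ `fderiv_apply_mem_of_mapsTo`
— if `f : E → F` has `HasFDerivAt f f′ 0`, `f 0 = 0`, and maps `S` into the closed `S′`, then `f′ v ∈ S′` for every `v ∈ S` (the slope `t⁻¹·f(tv)`, `t ∈ ℝ`, lies in `S′` and tends to `f′v`);
`remainder_mem_of_mapsTo` — so does `f v − f′ v`.  §2 ★★ **`chartExponent_mem_of_mapsTo`** — with `C := fun A => f A − f′ A`, `H(S′) ⊆ S`, the contraction regime of `B11Prop3Model.Dfix_spec`,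
and `A′ ∈ S`: `Dfix C H C₂ A′ ∈ S′` and **`A′ − H(Dfix C H C₂ A′) ∈ S`** — print's (51) «for A′ with values in 𝔤 … D(A′) has values in 𝔤».  HONEST SCOPE: plumbing; the chart-specific input
«`f = logChartTw(ˢ) U₀` maps `i·𝔰𝔲(2)`-valued fields to `i·𝔰𝔲(2)`-valued data» (unitary averages + `log` of `SU(2)` near `1`) and the reality of the opaque `H`, `H₁`, `𝔊` stay to be supplied.

References: T. Bałaban, CMP 102 (1985) 277–309 [Balaban1985Variational] ((44)–(51) pp.285–286, (55) p.286, (112) p.294); CMP 99 (1985) 389–434 [Balaban1985BackgroundPropagators] ((3.13)–(3.14) p.393).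
-/

set_option autoImplicit false

noncomputable section

open Metric Set Filter Topology

namespace Summit.QuantumFields.YangMills.Theorems.Prop7ChartRealitySplit

open Literature.MathematicalPhysics.QuantumFieldTheory.Balaban1983to89
open B13Contraction113 (QuadAnalytic)
open B11Prop3Model (Dfix)
open Summit.QuantumFields.YangMills.Theorems.Prop7DfixInvariant (Dfix_mem_of_invariant)

variable {E F : Type*} [NormedAddCommGroup E] [NormedSpace ℂ E] [NormedAddCommGroup F] [NormedSpace ℂ F]

/-! ## §1 The linear part and the remainder of a real-subspace-preserving map preserve the real subspaces -/

/-- ★ **THE DERIVATIVE OF AN `S → S′` MAP SENDS `S` INTO THE CLOSED `S′`** (real subspaces of complex Banach spaces; derivative at `0`, `f 0 = 0`): the real slope `t⁻¹·(f(tv) − f 0)` lies in `S′`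
for every real `t ≠ 0` and tends to `f′v`. [cite: Balaban1985Variational, (51) p.286; Balaban1985BackgroundPropagators, (3.14) p.393] -/
theorem fderiv_apply_mem_of_mapsTo {f : E → F} {f' : E →L[ℂ] F} (hf : HasFDerivAt f f' 0) (hf0 : f 0 = 0)
    (S : Submodule ℝ E) (S' : Submodule ℝ F) (hS' : IsClosed (S' : Set F)) (hmaps : ∀ y ∈ S, f y ∈ S') {v : E} (hv : v ∈ S) :
    f' v ∈ S' := by
  -- the line `t ↦ f (t • v)` has derivative `f′ v` at `0`
  have hℓ : HasDerivAt (fun t : ℝ => t • v) v 0 := by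
    simpa using (hasDerivAt_id (0:ℝ)).smul_const v
  have hf' : HasFDerivAt f (f'.restrictScalars ℝ) ((fun t : ℝ => t • v) 0) := by
    simp only [zero_smul]; exact hf.restrictScalars ℝ
  have hg : HasDerivAt (fun t : ℝ => f (t • v)) (f' v) 0 := by
    have h : HasDerivAt (f ∘ fun t : ℝ => t • v) ((f'.restrictScalars ℝ) v) 0 := hf'.comp_hasDerivAt (0:ℝ) hℓ
    exact h
  -- its slopes lie in `S′`
  refine hS'.mem_of_tendsto hg.tendsto_slope_zero (Filter.Eventually.of_forall fun t => ?_)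
  have h1 : f (((0:ℝ) + t) • v) ∈ S' := hmaps _ (S.smul_mem _ hv)
  have h2 : f ((0:ℝ) • v) ∈ S' := by rw [zero_smul, hf0]; exact S'.zero_mem
  exact S'.smul_mem _ (S'.sub_mem h1 h2)

/-- **THE REMAINDER `C = f − f′(0)` OF AN `S → S′` MAP SENDS `S` INTO `S′`** ((3.14): «C_j(U, A) is an analytic function of A whose expansion begins with second order terms» — real for real `A`).
[cite: Balaban1985BackgroundPropagators, (3.14) p.393; Balaban1985Variational, (44) p.285, (51) p.286] -/
theorem remainder_mem_of_mapsTo {f : E → F} {f' : E →L[ℂ] F} (hf : HasFDerivAt f f' 0) (hf0 : f 0 = 0)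
    (S : Submodule ℝ E) (S' : Submodule ℝ F) (hS' : IsClosed (S' : Set F)) (hmaps : ∀ y ∈ S, f y ∈ S') {v : E} (hv : v ∈ S) :
    f v - f' v ∈ S' :=
  S'.sub_mem (hmaps v hv) (fderiv_apply_mem_of_mapsTo hf hf0 S S' hS' hmaps hv)

/-! ## §2 The chart exponent `A′ − H D(A′)` is real for real `A′` -/

/-- ★★ **PRINT'S (51): «FOR A′ WITH VALUES IN 𝔤 THE CONFIGURATION D(A′) HAS VALUES IN 𝔤», AND SO DOES THE CHART EXPONENT `A′ − HD(A′)`** — for the remainder `C = f − f′(0)` of any chart `f`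
mapping the real fields `S` into the real data `S′` (`f 0 = 0`), any `ℂ`-linear `H` mapping `S′` into `S`, inside the contraction regime of `B11Prop3Model.Dfix_spec` (`QuadAnalytic C C₂ R`,
`‖HX‖ ≤ b‖X‖`, `9C₂bε < 1`, `3ε ≤ R`, `‖A′‖ < ε`): `Dfix C H C₂ A′ ∈ S′` (`Prop7DfixInvariant.Dfix_mem_of_invariant` on the closed invariant `S′`) and `A′ − H(Dfix C H C₂ A′) ∈ S`.
[cite: Balaban1985Variational, (47)–(51) pp.285–286, (55) p.286, Prop. 3 p.289, (112) p.294] -/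
theorem chartExponent_mem_of_mapsTo [CompleteSpace F] {f : E → F} {f' : E →L[ℂ] F} (hf : HasFDerivAt f f' 0) (hf0 : f 0 = 0)
    (S : Submodule ℝ E) (S' : Submodule ℝ F) (hS' : IsClosed (S' : Set F)) (hmaps : ∀ y ∈ S, f y ∈ S')
    {H : F →ₗ[ℂ] E} (hH : ∀ X ∈ S', H X ∈ S)
    {C₂ R b ε : ℝ} (hC : QuadAnalytic (fun A => f A - f' A) C₂ R) (hC₂ : 0 ≤ C₂) (hb : 0 ≤ b) (hHop : ∀ X, ‖H X‖ ≤ b * ‖X‖)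
    (hq : 9 * C₂ * b * ε < 1) (hRC : 3 * ε ≤ R) {A : E} (hAε : ‖A‖ < ε) (hA : A ∈ S) :
    Dfix (fun A => f A - f' A) H C₂ A ∈ S' ∧ A - H (Dfix (fun A => f A - f' A) H C₂ A) ∈ S := by
  have hD : Dfix (fun A => f A - f' A) H C₂ A ∈ S' :=
    Dfix_mem_of_invariant hC hC₂ hb hHop hq hRC hAε hS' S'.zero_mem
      (fun X hX => remainder_mem_of_mapsTo hf hf0 S S' hS' hmaps (S.sub_mem hA (hH X hX)))
  exact ⟨hD, S.sub_mem hA (hH _ hD)⟩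

end Summit.QuantumFields.YangMills.Theorems.Prop7ChartRealitySplit

end
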